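import Summits.CriticalPhenomena.PercolationContinuityZ3.Theses.PercLowPointHalfSpace
import Literature.Probability.Percolation.CriticalContinuityProofs
import Literature.Probability.Percolation.SlabCriticality
import Literature.Probability.Percolation.InequalitiesProofs

/-!
# Disproof of `TallClusterMassBound` — findings (cdisprove, crux stmt-CriticalPhenomena-0912, gen 1)

Crux (route PercLowPointHalfSpace, item B, rank 3; `Theses.PercLowPointHalfSpace.TallClusterMassBound`):
`∃ C, ∀ r ≥ 1, Σ_{x ∈ box 3 r} P_{p_c}(0 ↔_ℍ x ∧ arm_ℍ(0,r)) ≤ C r^{11/4} P_{p_c}(arm_ℍ(0,r))`, `ℍ = {x | 0 ≤ x₀}`,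
`arm_ℍ(0,r) = {∃ y, (∃ i, r ≤ |y i|) ∧ 0 ↔_ℍ y}`, `p_c = criticalProbI 3` (a genuine interior critical point:
`0 < p_c(ℤ³) < 1` is PROVED in the tree, `criticalProb_zd_pos` / `Grimmett1999_criticalProb_pos_lt_one_holds`).
Informally: the conditional mass exponent `m` of TALL critical half-space clusters rooted on the wall is `≤ 11/4 < 3`.

VERDICT (gen 1): NO KILL, and none is possible short of refuting the conjunct itself. The statement is well typed
(no junk: terms with `x ∉ ℍ` vanish, `rpow` at `r ≥ 1`, `.real` of measurable events), purely asymptotic (§6: no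
finite computation can refute it), true in the real world with margin `11/4 − d_f ≈ 0.23` (§8.2), and violated only
in the counterfactual jump world `θ(p_c) > 0` (dense wall clusters, `m = 3`), where the density that would kill it is
exactly what BGN forbids us to exhibit (§3, §8.3). Every `theorem` below is checked (rc 0, no `sorry`).

INDEX
* §0 `MassBoundAt p s` — the two-parameter family `M_p(r) ≤ C r^s π_p(r)`; `tallClusterMassBound_iff` : crux ↔
  `MassBoundAt p_c (11/4)` (by `Iff.rfl`).
* §1 `massBoundAt_three` (exponent 3 is free for EVERY p — the content is the `1/4`), `massBoundAt_mono`.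
* §2 `succ_mul_armProb_le_mass` : `(r+1) π_p(r) ≤ M_p(r)` (lattice-path intermediate values) ⇒
  `not_massBoundAt_criticalProbI_of_lt_one` : ¬`MassBoundAt p_c s` for all `s < 1` (rigorous floor `m ≥ 1`);
  `armProb_pos` / `armProb_criticalProbI_pos` (open column, `p_c > 0`).
* §3 LOAD-BEARING = criticality from above: `not_massBoundAt_of_dense` (UniformlyDense p c, c > 0 ⇒ ¬`MassBoundAt p s`,
  s < 3 — the formal 'dense ⇒ m = 3'); `uniformlyDense_one`, `not_massBoundAt_one`,
  `tallClusterMassBound_false_without_criticality` : ¬`MassBoundAt 1 (11/4)` (all half-box edges open a.s. at p = 1).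
* §4 STRENGTHENING REFUTED: `not_densityBoundAt_criticalProbI` — no UNIFORM density bound `ρ_r(x) ≤ C r^{s-3}` (any
  s < 3): `ρ_r(0) = 1`; B is an averaged statement; `DensityBoundAt.massBoundAt` (uniform ⇒ averaged).
* §4b POSITIVE ASSOCIATION (Harris–FKG, tree `harris_fkg_holds`): `chiH_mul_armProb_le_mass` : `χ_ℍ^{(r)}(p) π_p(r)
  ≤ M_p(r)`; `chiH_criticalProbI_le_of_tallClusterMassBound` : B ⇒ `E_{p_c}|C_ℍ(0) ∩ B_r| ≤ C r^{11/4}` — a strictly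
  weaker, still OPEN shadow of B (BGN gives `o(r³)` without rate); `density_ge_tau` : `ρ_r(x) ≥ τ_ℍ(0,x)` for all r.
* §5 `massBoundAt_zero` : at p = 0 the family is vacuous (π = 0) — no obstruction on the subcritical side.
* §6 `massBoundAt_of_eventually`, `tallClusterMassBound_iff_eventually` : eventual ⇔ all r ≥ 1 (π > 0): the crux is a
  pure exponent statement; finite-r numerics can support or discourage, never refute.
* §7 `family_summary`.  — Targets: none yet (no skeleton / stuck stubs at gen 1).
* §8 WHY IT RESISTS / what a proof must use / exponent dictionary / dimension dependence / numerics / literature.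
-/

noncomputable section

open MeasureTheory ProbabilityTheory Filter
open Literature.Probability.Percolation Literature.Probability.LatticeModels
open Summit.CriticalPhenomena.PercolationContinuityZ3.Theses.PercLowPointHalfSpace (TallClusterMassBound)

namespace Summit.CriticalPhenomena.PercolationContinuityZ3.Cruxes.TallClusterMassBound.Disproof

/-! ## §0 Vocabulary: the crux as the point `(p, s) = (p_c, 11/4)` of a two-parameter family -/

/-- Vertices of `ℤ³`. [folklore] -/
abbrev V3 : Type := Site 3

/-- The half-space `ℍ = {x | 0 ≤ x₀}` exactly as written in the route file. [folklore] -/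
def Hs : Set V3 := {x | 0 ≤ x 0}

/-- Bond percolation on `ℤ³` at parameter `p`. [folklore] -/
def Pp (p : unitInterval) : Measure (BondConfig V3) := bondPercolation (zdGraph 3) p

/-- `P_p` is a probability measure. [folklore] -/
instance (p : unitInterval) : IsProbabilityMeasure (Pp p) := by
  unfold Pp; infer_instance

/-- `{0 ↔ x in ℍ}`. [folklore] -/
def conn (x : V3) : Set (BondConfig V3) := openConnIn Hs 0 x

/-- `arm_ℍ(0, r)`: the half-space cluster of `0` reaches sup-distance `≥ r`. [folklore] -/
def arm (r : ℕ) : Set (BondConfig V3) :=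
  {ω | ∃ y : V3, (∃ i : Fin 3, (r : ℤ) ≤ |y i|) ∧ ω ∈ openConnIn Hs 0 y}

/-- `M_p(r) = E_p[|C_ℍ(0) ∩ B_r| ; arm_ℍ(0,r)] = Σ_{x ∈ B_r} P_p(0 ↔_ℍ x, arm_ℍ(0,r))`. [folklore] -/
def mass (p : unitInterval) (r : ℕ) : ℝ := ∑ x ∈ box 3 r, (Pp p).real (conn x ∩ arm r)

/-- `π_p(r) = P_p(arm_ℍ(0, r))`. [folklore] -/
def armProb (p : unitInterval) (r : ℕ) : ℝ := (Pp p).real (arm r)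

/-- The two-parameter family: `M_p(r) ≤ C r^s π_p(r)` for all `r ≥ 1`. The crux is the point
`(p_c(ℤ³), 11/4)` (`tallClusterMassBound_iff`). [folklore] -/
def MassBoundAt (p : unitInterval) (s : ℝ) : Prop :=
  ∃ C : ℝ, ∀ r : ℕ, 1 ≤ r → mass p r ≤ C * (r : ℝ) ^ s * armProb p r

/-- The crux, verbatim, is `MassBoundAt p_c (11/4)`. [folklore] -/
theorem tallClusterMassBound_iff :
    TallClusterMassBound ↔ MassBoundAt (criticalProbI 3) ((11 : ℝ) / 4) := Iff.rfl

/-! ## §1 The content is the exponent: `s = 3` is free for EVERY `p`, and `s ↦ MassBoundAt p s` is monotone -/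

/-- `P_p(0 ↔_ℍ x ∧ arm_r) ≤ π_p(r)`. [folklore] -/
theorem real_conn_inter_arm_le (p : unitInterval) (x : V3) (r : ℕ) :
    (Pp p).real (conn x ∩ arm r) ≤ armProb p r :=
  measureReal_mono Set.inter_subset_right

/-- `π_p(r) ≥ 0`. [folklore] -/
theorem armProb_nonneg (p : unitInterval) (r : ℕ) : 0 ≤ armProb p r := measureReal_nonneg

/-- `π_p(r) ≤ 1`. [folklore] -/
theorem armProb_le_one (p : unitInterval) (r : ℕ) : armProb p r ≤ 1 := measureReal_le_one

/-- `M_p(r) ≥ 0`. [folklore] -/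
theorem mass_nonneg (p : unitInterval) (r : ℕ) : 0 ≤ mass p r :=
  Finset.sum_nonneg fun _ _ => measureReal_nonneg

/-- The trivial volume bound `M_p(r) ≤ |B_r| π_p(r) = (2r+1)³ π_p(r)`. [folklore] -/
theorem mass_le_card_mul (p : unitInterval) (r : ℕ) :
    mass p r ≤ (2 * (r : ℝ) + 1) ^ 3 * armProb p r := by
  unfold mass
  calc ∑ x ∈ box 3 r, (Pp p).real (conn x ∩ arm r)
      ≤ ∑ _x ∈ box 3 r, armProb p r := Finset.sum_le_sum fun x _ => real_conn_inter_arm_le p x r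
    _ = ((box 3 r).card : ℝ) * armProb p r := by rw [Finset.sum_const, nsmul_eq_mul]
    _ = (2 * (r : ℝ) + 1) ^ 3 * armProb p r := by rw [card_box]; push_cast; ring

/-- `MassBoundAt p 3` holds for every parameter `p` (with `C = 27`): exponent `3` carries no
information; the crux is exactly the improvement `3 ↦ 11/4`. [folklore] -/
theorem massBoundAt_three (p : unitInterval) : MassBoundAt p 3 := by
  refine ⟨27, fun r hr => (mass_le_card_mul p r).trans ?_⟩
  have hr' : (1 : ℝ) ≤ r := by exact_mod_cast hr
  have h3 : (r : ℝ) ^ (3 : ℝ) = (r : ℝ) ^ (3 : ℕ) := by exact_mod_cast Real.rpow_natCast (r : ℝ) 3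
  rw [h3]
  have hπ := armProb_nonneg p r
  have h27 : (2 * (r : ℝ) + 1) ^ 3 ≤ 27 * (r : ℝ) ^ (3 : ℕ) := by
    have : (2 * (r : ℝ) + 1) ^ 3 ≤ (3 * (r : ℝ)) ^ 3 :=
      pow_le_pow_left₀ (by linarith) (by linarith) 3
    linarith [show (3 * (r : ℝ)) ^ 3 = 27 * (r : ℝ) ^ 3 by ring]
  exact mul_le_mul_of_nonneg_right h27 hπ

/-- Monotonicity in the exponent (for `r ≥ 1`, `r^s ≤ r^t`). [folklore] -/
theorem massBoundAt_mono {p : unitInterval} {s t : ℝ} (hst : s ≤ t) (h : MassBoundAt p s) :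
    MassBoundAt p t := by
  obtain ⟨C, hC⟩ := h
  refine ⟨max C 0, fun r hr => (hC r hr).trans ?_⟩
  have hr' : (1 : ℝ) ≤ r := by exact_mod_cast hr
  have hπ := armProb_nonneg p r
  have h1 : C * (r : ℝ) ^ s ≤ max C 0 * (r : ℝ) ^ s :=
    mul_le_mul_of_nonneg_right (le_max_left _ _) (Real.rpow_nonneg (by linarith) _)
  have h2 : max C 0 * (r : ℝ) ^ s ≤ max C 0 * (r : ℝ) ^ t :=
    mul_le_mul_of_nonneg_left (Real.rpow_le_rpow_of_exponent_le hr' hst) (le_max_right _ _)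
  exact mul_le_mul_of_nonneg_right (h1.trans h2) hπ

/-! ## §1b An analytic helper: `c r^t ≤ C r^s` for all `r ≥ 1` is impossible when `s < t`, `c > 0` -/

/-- For `a > 0` the powers `r^a`, `r ∈ ℕ`, are unbounded. [folklore] -/
theorem exists_nat_lt_rpow (C : ℝ) {a : ℝ} (ha : 0 < a) : ∃ r : ℕ, 1 ≤ r ∧ C < (r : ℝ) ^ a := by
  have h1 : Tendsto (fun r : ℕ => (r : ℝ) ^ a) atTop atTop :=
    (tendsto_rpow_atTop ha).comp tendsto_natCast_atTop_atTop
  obtain ⟨r, hr⟩ := ((h1.eventually_gt_atTop C).and (eventually_ge_atTop 1)).exists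
  exact ⟨r, hr.2, hr.1⟩

/-- If `0 < c` and `s < t` then `c r^t ≤ C r^s` fails for some natural `r ≥ 1`. [folklore] -/
theorem not_forall_rpow_le {c C s t : ℝ} (hc : 0 < c) (hst : s < t) :
    ¬ ∀ r : ℕ, 1 ≤ r → c * (r : ℝ) ^ t ≤ C * (r : ℝ) ^ s := by
  intro h
  obtain ⟨r, hr1, hr⟩ := exists_nat_lt_rpow (C / c) (sub_pos.2 hst)
  have hr0 : (0 : ℝ) < r := by exact_mod_cast hr1
  have key := h r hr1
  have hsplit : (r : ℝ) ^ t = (r : ℝ) ^ (t - s) * (r : ℝ) ^ s := by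
    rw [← Real.rpow_add hr0]; ring_nf
  have hrs : 0 < (r : ℝ) ^ s := Real.rpow_pos_of_pos hr0 s
  have hlt : C * (r : ℝ) ^ s < c * (r : ℝ) ^ t := by
    rw [hsplit]
    have : C < c * (r : ℝ) ^ (t - s) := by
      have := mul_lt_mul_of_pos_left hr hc
      rwa [mul_div_cancel₀ _ hc.ne'] at this
    calc C * (r : ℝ) ^ s < c * (r : ℝ) ^ (t - s) * (r : ℝ) ^ s := mul_lt_mul_of_pos_right this hrs
      _ = c * ((r : ℝ) ^ (t - s) * (r : ℝ) ^ s) := by ring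
  linarith


/-! ## §2 A rigorous LOWER bound `M_p(r) ≥ (r+1) π_p(r)`: the over-strengthening `s < 1` is false

On `arm_ℍ(0,r)` an open lattice path in `ℍ` runs from `0` to sup-distance `≥ r`; its sup-norm changes
by at most one per step, so it visits vertices of every sup-norm `0, 1, …, r`, all in `B_r` and all
joined to `0` in `ℍ`: `|C_ℍ(0) ∩ B_r| ≥ r + 1` on the arm event (for configurations opening only
lattice edges, an almost sure event). -/

/-- The sup-norm on `ℤ³`, written out coordinatewise. [folklore] -/
def snorm (z : V3) : ℕ := max (max (z 0).natAbs (z 1).natAbs) (z 2).natAbs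

/-- `∀ i : Fin 3` unrolled. [folklore] -/
theorem forall_fin3 {P : Fin 3 → Prop} : (∀ i, P i) ↔ P 0 ∧ P 1 ∧ P 2 :=
  ⟨fun h => ⟨h 0, h 1, h 2⟩, fun h i => by fin_cases i; exacts [h.1, h.2.1, h.2.2]⟩

/-- The origin has sup-norm `0`. [folklore] -/
@[simp] theorem snorm_zero : snorm 0 = 0 := by simp [snorm]

/-- `box 3 r` is the sup-norm ball of radius `r`. [folklore] -/
theorem mem_box_iff_snorm {r : ℕ} {z : V3} : z ∈ box 3 r ↔ snorm z ≤ r := by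
  rw [mem_box, forall_fin3]
  simp only [snorm]
  omega

/-- The route's 'far' predicate `∃ i, r ≤ |z i|` is `r ≤ ‖z‖∞`. [folklore] -/
theorem far_iff_snorm {r : ℕ} {z : V3} : (∃ i : Fin 3, (r : ℤ) ≤ |z i|) ↔ r ≤ snorm z := by
  rw [exists_fin_three]
  simp only [snorm, Int.abs_eq_natAbs, Nat.cast_le]
  omega

/-- One lattice step changes the sup-norm by at most one. [folklore] -/
theorem snorm_le_of_adj {z z' : V3} (h : (zdGraph 3).Adj z z') : snorm z' ≤ snorm z + 1 := by
  rw [zdGraph_adj_iff] at h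
  obtain ⟨i, h | h⟩ := h
  · subst h
    fin_cases i <;> simp [snorm] <;> omega
  · subst h
    fin_cases i <;> simp [snorm] <;> omega

/-- Discrete intermediate values along a walk for a function with unit upward steps. [folklore] -/
theorem exists_mem_support_eq {W : Type*} {K : SimpleGraph W} (f : W → ℕ)
    (hf : ∀ u v, K.Adj u v → f v ≤ f u + 1) {u v : W} (w : K.Walk u v) {k : ℕ}
    (hku : f u ≤ k) (hkv : k ≤ f v) : ∃ z ∈ w.support, f z = k := by
  induction w with
  | @nil u => exact ⟨u, by simp, le_antisymm hku hkv⟩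
  | @cons a b c hab w ih =>
    by_cases hk : f a = k
    · exact ⟨a, by simp, hk⟩
    · have hb : f b ≤ k := by have := hf a b hab; omega
      obtain ⟨z, hz, hfz⟩ := ih hb hkv
      exact ⟨z, by simp [hz], hfz⟩

/-- `0 ∈ ℍ`. [folklore] -/
theorem zero_mem_Hs : (0 : V3) ∈ Hs := by
  change (0 : ℤ) ≤ (0 : V3) 0
  simp

/-- `ω ∈ conn x` is reachability `0 → x` in the graph of open steps inside `ℍ`. [folklore] -/
theorem mem_conn_iff {ω : BondConfig V3} {x : V3} :
    ω ∈ conn x ↔ (openGraph ω ⊓ withinGraph ⊤ Hs).Reachable 0 x := by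
  rw [conn, openConnIn_eq_openConnVia zero_mem_Hs]
  exact mem_openClusterIn_iff

/-- `ω ∈ arm r` is: some `y` with `‖y‖∞ ≥ r` is reachable from `0` by open steps inside `ℍ`. [folklore] -/
theorem mem_arm_iff {ω : BondConfig V3} {r : ℕ} :
    ω ∈ arm r ↔ ∃ y : V3, r ≤ snorm y ∧ (openGraph ω ⊓ withinGraph ⊤ Hs).Reachable 0 y := by
  simp only [arm, Set.mem_setOf_eq, far_iff_snorm]
  refine exists_congr fun y => and_congr_right fun _ => ?_
  rw [openConnIn_eq_openConnVia zero_mem_Hs]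
  exact mem_openClusterIn_iff

open scoped Classical in
/-- COUNTING LEMMA: on the arm event, at least `r + 1` vertices of `B_r` are joined to `0` in `ℍ`
(configurations opening only lattice edges). [folklore] -/
theorem card_conn_ge {ω : BondConfig V3} (hω : ω ⊆ (zdGraph 3).edgeSet) {r : ℕ} (hr : ω ∈ arm r) :
    r + 1 ≤ ((box 3 r).filter fun x => ω ∈ conn x).card := by
  classical
  obtain ⟨y, hy, ⟨w⟩⟩ := mem_arm_iff.1 hr
  have hK : ∀ u v, (openGraph ω ⊓ withinGraph ⊤ Hs).Adj u v → snorm v ≤ snorm u + 1 := by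
    intro u v h
    have h1 : (openGraph ω).Adj u v := h.1
    rw [openGraph_adj] at h1
    exact snorm_le_of_adj ((SimpleGraph.mem_edgeSet (G := zdGraph 3)).1 (hω h1.1))
  have hex : ∀ k, k ≤ r → ∃ z, z ∈ w.support ∧ snorm z = k := fun k hk =>
    exists_mem_support_eq snorm hK w (by simp) (hk.trans hy)
  choose! g hg using hex
  have hmaps : Set.MapsTo g ↑(Finset.range (r + 1)) ↑((box 3 r).filter fun x => ω ∈ conn x) := by
    intro k hk
    rw [Finset.coe_range, Set.mem_Iio, Nat.lt_succ_iff] at hk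
    obtain ⟨hsupp, hnorm⟩ := hg k hk
    rw [Finset.mem_coe, Finset.mem_filter]
    refine ⟨mem_box_iff_snorm.2 (hnorm.le.trans hk), ?_⟩
    rw [mem_conn_iff]
    obtain ⟨q, -, -⟩ := SimpleGraph.Walk.mem_support_iff_exists_append.1 hsupp
    exact ⟨q⟩
  have hinj : Set.InjOn g ↑(Finset.range (r + 1)) := by
    intro a ha b hb hab
    rw [Finset.coe_range, Set.mem_Iio, Nat.lt_succ_iff] at ha hb
    rw [← (hg a ha).2, ← (hg b hb).2, hab]
  calc r + 1 = (Finset.range (r + 1)).card := (Finset.card_range _).symm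
    _ ≤ _ := Finset.card_le_card_of_injOn g hmaps hinj

/-- `{0 ↔_ℍ x}` is measurable. [folklore] -/
theorem measurableSet_conn (x : V3) : MeasurableSet (conn x) :=
  measurableSet_openConnIn_of_countable _ _ _

/-- `arm_ℍ(0,r)` is measurable (a countable union of connection events). [folklore] -/
theorem measurableSet_arm (r : ℕ) : MeasurableSet (arm r) := by
  have : arm r = ⋃ y : V3, ⋃ (_ : ∃ i : Fin 3, (r : ℤ) ≤ |y i|), openConnIn Hs 0 y := by
    ext ω; simp [arm]
  rw [this]
  exact MeasurableSet.iUnion fun y => MeasurableSet.iUnion fun _ =>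
    measurableSet_openConnIn_of_countable _ _ _

/-- Almost every configuration opens only lattice edges. [folklore] -/
theorem ae_subset_edgeSet (p : unitInterval) : ∀ᵐ ω ∂Pp p, ω ⊆ (zdGraph 3).edgeSet :=
  setBernoulli_ae_subset

/-- LOWER BOUND: `(r + 1) π_p(r) ≤ M_p(r)` for every `p` and `r`. [folklore] -/
theorem succ_mul_armProb_le_mass (p : unitInterval) (r : ℕ) :
    ((r : ℝ) + 1) * armProb p r ≤ mass p r := by
  classical
  have hA := measurableSet_arm r
  have hC := measurableSet_conn
  have lhs : ((r : ℝ) + 1) * armProb p r =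
      ∫ ω, ((r : ℝ) + 1) * (arm r).indicator (1 : BondConfig V3 → ℝ) ω ∂Pp p := by
    rw [integral_const_mul, integral_indicator_one hA]; rfl
  have rhs : mass p r =
      ∫ ω, ∑ x ∈ box 3 r, (conn x ∩ arm r).indicator (1 : BondConfig V3 → ℝ) ω ∂Pp p := by
    rw [integral_finsetSum]
    · refine Finset.sum_congr rfl fun x _ => ?_
      rw [integral_indicator_one ((hC x).inter hA)]
    · intro x _
      exact (integrable_const (1 : ℝ)).indicator ((hC x).inter hA)
  rw [lhs, rhs]
  refine integral_mono_ae ?_ ?_ ?_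
  · exact ((integrable_const (1 : ℝ)).indicator hA).const_mul _
  · exact integrable_finsetSum _ fun x _ => (integrable_const (1 : ℝ)).indicator ((hC x).inter hA)
  · filter_upwards [ae_subset_edgeSet p] with ω hω
    by_cases hω' : ω ∈ arm r
    · have hsum : ∑ x ∈ box 3 r, (conn x ∩ arm r).indicator (1 : BondConfig V3 → ℝ) ω =
          (((box 3 r).filter fun x => ω ∈ conn x).card : ℝ) := by
        rw [← Finset.sum_boole]
        refine Finset.sum_congr rfl fun x _ => ?_
        simp [Set.indicator_apply, hω']
      simp only [Set.indicator_of_mem hω', Pi.one_apply, mul_one, hsum]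
      exact_mod_cast card_conn_ge hω hω'
    · simp only [Set.indicator_of_notMem hω', mul_zero]
      exact Finset.sum_nonneg fun x _ => Set.indicator_nonneg (fun _ _ => zero_le_one) _

/-- `MassBoundAt p s` with `s < 1` is false as soon as the arm probabilities are positive. [folklore] -/
theorem not_massBoundAt_of_lt_one {p : unitInterval} (hπ : ∀ r : ℕ, 1 ≤ r → 0 < armProb p r)
    {s : ℝ} (hs : s < 1) : ¬ MassBoundAt p s := by
  rintro ⟨C, hC⟩
  refine not_forall_rpow_le (c := 1) (C := C) one_pos hs fun r hr => ?_
  have h := (succ_mul_armProb_le_mass p r).trans (hC r hr)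
  have h' : (r : ℝ) + 1 ≤ C * (r : ℝ) ^ s := le_of_mul_le_mul_right (by linarith) (hπ r hr)
  rw [Real.rpow_one]; linarith

/-! ### Positivity of the arm probabilities for `p > 0` (a straight open column), in particular at `p_c` -/

/-- The point `(k, 0, 0)` of the normal axis. [folklore] -/
def up (k : ℕ) : V3 := Pi.single 0 (k : ℤ)

/-- `up 0 = 0`. [folklore] -/
@[simp] theorem up_zero : up 0 = 0 := by simp [up]

/-- `up (k+1) = up k + e₀`. [folklore] -/
theorem up_succ (k : ℕ) : up (k + 1) = up k + Pi.single 0 1 := by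
  simp [up, ← Pi.single_add]

/-- The height of `up k` is `k`. [folklore] -/
theorem up_apply_zero (k : ℕ) : up k 0 = k := by simp [up]

/-- `up k ∈ ℍ`. [folklore] -/
theorem up_mem_Hs (k : ℕ) : up k ∈ Hs := by
  show (0 : ℤ) ≤ up k 0
  rw [up_apply_zero]; exact Int.natCast_nonneg k

/-- Consecutive points of the column are lattice neighbours. [folklore] -/
theorem adj_up_succ (k : ℕ) : (zdGraph 3).Adj (up k) (up (k + 1)) :=
  (zdGraph_adj_iff _ _).2 ⟨0, Or.inl (up_succ k)⟩

/-- The open column `{s(up k, up (k+1)) | k < r}`. [folklore] -/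
def column (r : ℕ) : Finset (Sym2 V3) := (Finset.range r).image fun k => s(up k, up (k + 1))

/-- The column consists of lattice edges. [folklore] -/
theorem column_subset_edgeSet (r : ℕ) : (↑(column r) : Set (Sym2 V3)) ⊆ (zdGraph 3).edgeSet := by
  intro e he
  rw [Finset.mem_coe, column, Finset.mem_image] at he
  obtain ⟨k, -, rfl⟩ := he
  exact (SimpleGraph.mem_edgeSet _).2 (adj_up_succ k)

/-- If the column is open, `up k` is reachable from `0` inside `ℍ` for `k ≤ r`. [folklore] -/
theorem reachable_up_of_column {ω : BondConfig V3} {r : ℕ} (hω : (↑(column r) : Set (Sym2 V3)) ⊆ ω)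
    {k : ℕ} (hk : k ≤ r) : (openGraph ω ⊓ withinGraph ⊤ Hs).Reachable 0 (up k) := by
  induction k with
  | zero => simp
  | succ k ih =>
    have hk' : k < r := Nat.lt_of_succ_le hk
    refine (ih hk'.le).trans (SimpleGraph.Adj.reachable ?_)
    have hne : up k ≠ up (k + 1) := (adj_up_succ k).ne
    have he : s(up k, up (k + 1)) ∈ ω := hω (by
      rw [Finset.mem_coe, column, Finset.mem_image]; exact ⟨k, Finset.mem_range.2 hk', rfl⟩)
    rw [SimpleGraph.inf_adj, openGraph_adj, withinGraph_adj, SimpleGraph.top_adj]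
    exact ⟨⟨he, hne⟩, hne, up_mem_Hs k, up_mem_Hs (k + 1)⟩

/-- An open column of height `r` realises `arm_ℍ(0,r)`. [folklore] -/
theorem setOf_column_subset_arm (r : ℕ) : {ω : BondConfig V3 | ↑(column r) ⊆ ω} ⊆ arm r := by
  intro ω hω
  rw [mem_arm_iff]
  refine ⟨up r, ?_, reachable_up_of_column hω le_rfl⟩
  simp [snorm, up]

/-- `π_p(r) ≥ p^{|column r|} > 0` for `p > 0`. [folklore] -/
theorem armProb_pos {p : unitInterval} (hp : 0 < (p : ℝ)) (r : ℕ) : 0 < armProb p r := by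
  have h := bondPercolation_real_setOf_subset (zdGraph 3) p (column r) (column_subset_edgeSet r)
  have hpos : 0 < (p : ℝ) ^ (column r).card := pow_pos hp _
  calc 0 < (Pp p).real {ω | ↑(column r) ⊆ ω} := by rw [Pp, h] at *; exact hpos
    _ ≤ armProb p r := measureReal_mono (setOf_column_subset_arm r)

/-- `p_c(ℤ³) > 0` (tree: `criticalProb_zd_pos`). [folklore] -/
theorem criticalProbI_pos : 0 < ((criticalProbI 3 : unitInterval) : ℝ) := by
  rw [coe_criticalProbI]; exact criticalProb_zd_pos 3 (by norm_num)

/-- `π_{p_c}(r) > 0` for every `r`. [folklore] -/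
theorem armProb_criticalProbI_pos (r : ℕ) : 0 < armProb (criticalProbI 3) r :=
  armProb_pos criticalProbI_pos r

/-- NATURAL STRENGTHENING REFUTED (exponent side): at `p_c(ℤ³)` the conditional mass exponent is
`≥ 1` — `MassBoundAt p_c s` is FALSE for every `s < 1`. (So the true `m` lies in `[1, 3]`; the crux
asserts `m ≤ 11/4`.) [folklore] -/
theorem not_massBoundAt_criticalProbI_of_lt_one {s : ℝ} (hs : s < 1) :
    ¬ MassBoundAt (criticalProbI 3) s :=
  not_massBoundAt_of_lt_one (fun r _ => armProb_criticalProbI_pos r) hs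


/-! ## §3 LOAD-BEARING: criticality from ABOVE. Dense half-space clusters force `m = 3`;
at `p = 1` (and, modulo half-space uniqueness + FKG, at every `p > p_c`) `MassBoundAt p s` fails for all `s < 3` -/

/-- The cube `{0,…,r}³ ⊆ B_r ∩ ℍ`. [folklore] -/
def cube (r : ℕ) : Finset V3 := Fintype.piFinset fun _ : Fin 3 => Finset.Icc (0 : ℤ) r

/-- The half-box `B_r ∩ ℍ`. [folklore] -/
def halfBox (r : ℕ) : Finset V3 := (box 3 r).filter fun x => 0 ≤ x 0

/-- `|cube r| = (r+1)³`. [folklore] -/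
theorem card_cube (r : ℕ) : (cube r).card = (r + 1) ^ 3 := by
  have h : ((r : ℤ) + 1 - 0).toNat = r + 1 := by omega
  rw [cube, Fintype.card_piFinset_const, Int.card_Icc, h]

/-- `cube r ⊆ B_r ∩ ℍ`. [folklore] -/
theorem cube_subset_halfBox (r : ℕ) : cube r ⊆ halfBox r := by
  intro x hx
  rw [cube, Fintype.mem_piFinset] at hx
  rw [halfBox, Finset.mem_filter, mem_box]
  exact ⟨fun i => by have := Finset.mem_Icc.1 (hx i); omega, (Finset.mem_Icc.1 (hx 0)).1⟩

/-- `B_r ∩ ℍ ⊆ B_r`. [folklore] -/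
theorem halfBox_subset_box (r : ℕ) : halfBox r ⊆ box 3 r := Finset.filter_subset _ _

/-- `cube r ⊆ B_r`. [folklore] -/
theorem cube_subset_box (r : ℕ) : cube r ⊆ box 3 r := (cube_subset_halfBox r).trans (halfBox_subset_box r)

/-- `up k ∈ cube r` for `k ≤ r`. [folklore] -/
theorem up_mem_cube {k r : ℕ} (hk : k ≤ r) : up k ∈ cube r := by
  rw [cube, Fintype.mem_piFinset, forall_fin3]
  simp only [up, Finset.mem_Icc]
  exact ⟨by simpa using hk, by simp, by simp⟩

/-- `UniformlyDense p c`: every vertex of the cube `{0,…,r}³` is joined to `0` in `ℍ` by a cluster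
reaching sup-distance `r`, with probability at least `c`, uniformly in `r ≥ 1`. For `p > p_c(ℤ³)` this
holds with `c = θ_ℍ(p)² > 0` by Grimmett–Marstrand (`p_c(ℍ) = p_c`, tree fact
`GrimmettMarstrand1990_halfSpace`), Harris–FKG and uniqueness of the infinite `ℍ`-cluster — standard,
not formalised here; at `p = 1` it holds with `c = 1` (`uniformlyDense_one`, proved). In a hypothetical
jump world it FAILS at `p_c` itself (BGN: `θ_ℍ(p_c) = 0` unconditionally), which is why §3 does not
refute the crux. [folklore] -/
def UniformlyDense (p : unitInterval) (c : ℝ) : Prop :=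
  ∀ r : ℕ, 1 ≤ r → ∀ x ∈ cube r, c ≤ (Pp p).real (conn x ∩ arm r)

/-- Under `UniformlyDense p c`: `c (r+1)³ ≤ M_p(r)`. [folklore] -/
theorem mass_ge_of_dense {p : unitInterval} {c : ℝ} (h : UniformlyDense p c) {r : ℕ} (hr : 1 ≤ r) :
    c * ((r : ℝ) + 1) ^ 3 ≤ mass p r := by
  unfold mass
  calc c * ((r : ℝ) + 1) ^ 3 = ∑ _x ∈ cube r, c := by
        rw [Finset.sum_const, nsmul_eq_mul, card_cube]; push_cast; ring
    _ ≤ ∑ x ∈ cube r, (Pp p).real (conn x ∩ arm r) := Finset.sum_le_sum fun x hx => h r hr x hx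
    _ ≤ ∑ x ∈ box 3 r, (Pp p).real (conn x ∩ arm r) :=
        Finset.sum_le_sum_of_subset_of_nonneg (cube_subset_box r) fun _ _ _ => measureReal_nonneg

/-- DENSE ⇒ `m = 3`: under `UniformlyDense p c`, `c > 0`, the bound `MassBoundAt p s` fails for every
`s < 3`. This is the formal content of "a jump world has finite but DENSE half-space clusters, `m = 3`"
— except that density in this uniform sense is exactly what BGN denies AT `p_c`. [folklore] -/
theorem not_massBoundAt_of_dense {p : unitInterval} {c : ℝ} (hc : 0 < c) (h : UniformlyDense p c)
    {s : ℝ} (hs : s < 3) : ¬ MassBoundAt p s := by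
  rintro ⟨C, hC⟩
  refine not_forall_rpow_le (c := c) (C := |C|) hc hs fun r hr => ?_
  have h1 := mass_ge_of_dense h hr
  have h2 := hC r hr
  have hπ := armProb_le_one p r
  have hπ0 := armProb_nonneg p r
  have hr0 : (0 : ℝ) ≤ r := by positivity
  have hrs : 0 ≤ (r : ℝ) ^ s := Real.rpow_nonneg hr0 s
  have h3 : (r : ℝ) ^ (3 : ℝ) = (r : ℝ) ^ (3 : ℕ) := by exact_mod_cast Real.rpow_natCast (r : ℝ) 3
  have h4a : C * (r : ℝ) ^ s * armProb p r ≤ |C| * (r : ℝ) ^ s * armProb p r :=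
    mul_le_mul_of_nonneg_right (mul_le_mul_of_nonneg_right (le_abs_self C) hrs) hπ0
  have h4b : |C| * (r : ℝ) ^ s * armProb p r ≤ |C| * (r : ℝ) ^ s := by
    have := mul_le_mul_of_nonneg_left hπ (mul_nonneg (abs_nonneg C) hrs)
    simpa using this
  have h5 : c * (r : ℝ) ^ (3 : ℕ) ≤ c * ((r : ℝ) + 1) ^ 3 := by gcongr; linarith
  rw [h3]
  linarith

/-! ### The instance `p = 1`: all lattice edges are open a.s., `UniformlyDense 1 1` -/

/-- The lattice edges with both endpoints in the half-box. [folklore] -/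
def boxEdges (r : ℕ) : Finset (Sym2 V3) :=
  ((halfBox r ×ˢ halfBox r).filter fun e => (zdGraph 3).Adj e.1 e.2).image fun e => s(e.1, e.2)

/-- `boxEdges r` consists of lattice edges. [folklore] -/
theorem boxEdges_subset_edgeSet (r : ℕ) : (↑(boxEdges r) : Set (Sym2 V3)) ⊆ (zdGraph 3).edgeSet := by
  intro e he
  rw [Finset.mem_coe, boxEdges, Finset.mem_image] at he
  obtain ⟨e, he, rfl⟩ := he
  exact (SimpleGraph.mem_edgeSet _).2 (Finset.mem_filter.1 he).2

/-- If all half-box edges are open, lattice neighbours in the half-box are joined by an open step inside `ℍ`. [folklore] -/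
theorem adj_of_boxEdges {ω : BondConfig V3} {r : ℕ} (hω : (↑(boxEdges r) : Set (Sym2 V3)) ⊆ ω)
    {x x' : V3} (hx : x ∈ halfBox r) (hx' : x' ∈ halfBox r) (h : (zdGraph 3).Adj x x') :
    (openGraph ω ⊓ withinGraph ⊤ Hs).Adj x x' := by
  have he : s(x, x') ∈ ω := hω (by
    rw [Finset.mem_coe, boxEdges, Finset.mem_image]
    exact ⟨(x, x'), Finset.mem_filter.2 ⟨Finset.mem_product.2 ⟨hx, hx'⟩, h⟩, rfl⟩)
  rw [SimpleGraph.inf_adj, openGraph_adj, withinGraph_adj, SimpleGraph.top_adj]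
  exact ⟨⟨he, h.ne⟩, h.ne, (Finset.mem_filter.1 hx).2, (Finset.mem_filter.1 hx').2⟩

/-- If every lattice edge of the half-box is open, every vertex of the half-box is joined to `0` inside
`ℍ` (move one coordinate towards `0` at a time; the half-box is invariant under these moves).
[folklore] -/
theorem reachable_zero_of_boxEdges {ω : BondConfig V3} {r : ℕ} (hω : (↑(boxEdges r) : Set (Sym2 V3)) ⊆ ω)
    {x : V3} (hx : x ∈ halfBox r) : (openGraph ω ⊓ withinGraph ⊤ Hs).Reachable x 0 := by
  suffices H : ∀ m : ℕ, ∀ x : V3, x ∈ halfBox r → ∑ i, (x i).natAbs = m →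
      (openGraph ω ⊓ withinGraph ⊤ Hs).Reachable x 0 from H _ x hx rfl
  intro m
  induction m using Nat.strong_induction_on with
  | _ m ih =>
    intro x hx hm
    by_cases h0 : x = 0
    · subst h0; rfl
    · obtain ⟨i, hi⟩ : ∃ i, x i ≠ 0 := by
        by_contra h
        push Not at h
        exact h0 (funext h)
      have hxbox : ∀ j, -(r : ℤ) ≤ x j ∧ x j ≤ r := mem_box.1 (Finset.mem_filter.1 hx).1
      have hx0 : 0 ≤ x 0 := (Finset.mem_filter.1 hx).2
      set v : ℤ := if 0 < x i then x i - 1 else x i + 1 with hv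
      set x' : V3 := Function.update x i v with hx'
      have hx'j : ∀ j, j ≠ i → x' j = x j := fun j hj => by simp [hx', hj]
      have hx'i : x' i = v := by simp [hx']
      have hx'half : x' ∈ halfBox r := by
        rw [halfBox, Finset.mem_filter, mem_box]
        refine ⟨fun j => ?_, ?_⟩
        · rcases eq_or_ne j i with rfl | hj
          · rw [hx'i, hv]; have := hxbox j; split_ifs <;> omega
          · rw [hx'j j hj]; exact hxbox j
        · rcases eq_or_ne (0 : Fin 3) i with h0i | h0i
          · subst h0i; rw [hx'i, hv]; split_ifs <;> omega
          · rw [hx'j 0 h0i]; exact hx0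
      have hadj : (zdGraph 3).Adj x x' := by
        rw [zdGraph_adj_iff]
        refine ⟨i, ?_⟩
        by_cases hpos : 0 < x i
        · right
          funext j
          rcases eq_or_ne j i with rfl | hj
          · simp [hx'i, hv, hpos]
          · simp [hx'j j hj, hj]
        · left
          funext j
          rcases eq_or_ne j i with rfl | hj
          · simp [hx'i, hv, hpos]
          · simp [hx'j j hj, hj]
      have hlt : ∑ j, (x' j).natAbs < m := by
        rw [← hm]
        apply Finset.sum_lt_sum
        · intro j _
          rcases eq_or_ne j i with rfl | hj
          · rw [hx'i, hv]; split_ifs <;> omega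
          · rw [hx'j j hj]
        · refine ⟨i, Finset.mem_univ _, ?_⟩
          rw [hx'i, hv]; split_ifs <;> omega
      exact (adj_of_boxEdges hω hx hx'half hadj).reachable.trans (ih _ hlt x' hx'half rfl)

/-- If all half-box edges are open, every half-box vertex is joined to `0` in `ℍ`. [folklore] -/
theorem conn_of_boxEdges {ω : BondConfig V3} {r : ℕ} (hω : (↑(boxEdges r) : Set (Sym2 V3)) ⊆ ω)
    {x : V3} (hx : x ∈ halfBox r) : ω ∈ conn x :=
  mem_conn_iff.2 (reachable_zero_of_boxEdges hω hx).symm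

/-- If all half-box edges are open, `arm_ℍ(0,r)` holds (witness `up r`). [folklore] -/
theorem arm_of_boxEdges {ω : BondConfig V3} {r : ℕ} (hω : (↑(boxEdges r) : Set (Sym2 V3)) ⊆ ω) :
    ω ∈ arm r :=
  mem_arm_iff.2 ⟨up r, by simp [snorm, up],
    (reachable_zero_of_boxEdges hω (cube_subset_halfBox r (up_mem_cube le_rfl))).symm⟩

/-- At `p = 1`: `P_1(0 ↔_ℍ x, arm_ℍ(0,r)) = 1` for every `x ∈ B_r ∩ ℍ`. [folklore] -/
theorem real_conn_inter_arm_one {r : ℕ} {x : V3} (hx : x ∈ halfBox r) :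
    (Pp 1).real (conn x ∩ arm r) = 1 := by
  apply le_antisymm measureReal_le_one
  have h := bondPercolation_real_setOf_subset (zdGraph 3) 1 (boxEdges r) (boxEdges_subset_edgeSet r)
  rw [Set.Icc.coe_one, one_pow] at h
  calc (1 : ℝ) = (Pp 1).real {ω | ↑(boxEdges r) ⊆ ω} := by rw [Pp, h]
    _ ≤ _ := measureReal_mono (show {ω : BondConfig V3 | ↑(boxEdges r) ⊆ ω} ⊆ conn x ∩ arm r from
        fun ω hω => ⟨conn_of_boxEdges hω hx, arm_of_boxEdges hω⟩)

/-- At `p = 1` the family is uniformly dense with `c = 1`. [folklore] -/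
theorem uniformlyDense_one : UniformlyDense 1 1 := fun r _ _ hx =>
  (real_conn_inter_arm_one (cube_subset_halfBox r hx)).ge

/-- LOAD-BEARING THEOREM (any proof must use `p ≤ p_c`, quantitatively): the crux's inequality with
`p_c` replaced by `p = 1` is FALSE for every exponent `s < 3`, in particular for `s = 11/4`:
`M_1(r) ≥ (r+1)³` while `π_1(r) = 1`. [folklore] -/
theorem not_massBoundAt_one {s : ℝ} (hs : s < 3) : ¬ MassBoundAt 1 s :=
  not_massBoundAt_of_dense one_pos uniformlyDense_one hs

/-- The crux's shape `TallClusterMassBoundAt p := MassBoundAt p (11/4)` is false at `p = 1`. [folklore] -/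
theorem tallClusterMassBound_false_without_criticality : ¬ MassBoundAt 1 ((11 : ℝ) / 4) :=
  not_massBoundAt_one (by norm_num)

/-! ## §4 NATURAL STRENGTHENING REFUTED: no UNIFORM density bound. The conditional density
`ρ_r(x) = P(0 ↔_ℍ x | arm_ℍ(0,r))` is `≡ 1` at the root, so `ρ_r(x) ≤ C r^{s-3}` uniformly in `x ∈ B_r`
fails for every `s < 3` and every `p > 0`; the crux is an AVERAGED statement (decay of `ρ_r` in `|x|`). -/

/-- Uniform (pointwise-in-`x`) density version of the crux. [folklore] -/
def DensityBoundAt (p : unitInterval) (s : ℝ) : Prop :=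
  ∃ C : ℝ, ∀ r : ℕ, 1 ≤ r → ∀ x ∈ box 3 r,
    (Pp p).real (conn x ∩ arm r) ≤ C * (r : ℝ) ^ (s - 3) * armProb p r

/-- The uniform density bound implies the crux's shape (sum over `|B_r| ≤ 27 r³` terms). [folklore] -/
theorem DensityBoundAt.massBoundAt {p : unitInterval} {s : ℝ} (h : DensityBoundAt p s) :
    MassBoundAt p s := by
  obtain ⟨C, hC⟩ := h
  refine ⟨27 * max C 0, fun r hr => ?_⟩
  have hr' : (1 : ℝ) ≤ r := by exact_mod_cast hr
  have hr0 : (0 : ℝ) < r := by linarith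
  have hπ0 := armProb_nonneg p r
  have hrs : 0 ≤ (r : ℝ) ^ (s - 3) := Real.rpow_nonneg hr0.le _
  have h27 : (2 * (r : ℝ) + 1) ^ 3 ≤ 27 * (r : ℝ) ^ (3 : ℕ) := by
    have : (2 * (r : ℝ) + 1) ^ 3 ≤ (3 * (r : ℝ)) ^ 3 :=
      pow_le_pow_left₀ (by linarith) (by linarith) 3
    linarith [show (3 * (r : ℝ)) ^ 3 = 27 * (r : ℝ) ^ 3 by ring]
  have hsplit : (r : ℝ) ^ s = (r : ℝ) ^ (3 : ℕ) * (r : ℝ) ^ (s - 3) := by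
    have h3 : (r : ℝ) ^ (3 : ℝ) = (r : ℝ) ^ (3 : ℕ) := by exact_mod_cast Real.rpow_natCast (r : ℝ) 3
    rw [← h3, ← Real.rpow_add hr0]; ring_nf
  have hK : 0 ≤ max C 0 * (r : ℝ) ^ (s - 3) * armProb p r :=
    mul_nonneg (mul_nonneg (le_max_right _ _) hrs) hπ0
  calc mass p r ≤ ∑ _x ∈ box 3 r, max C 0 * (r : ℝ) ^ (s - 3) * armProb p r := by
        unfold mass
        refine Finset.sum_le_sum fun x hx => (hC r hr x hx).trans ?_
        exact mul_le_mul_of_nonneg_right (mul_le_mul_of_nonneg_right (le_max_left _ _) hrs) hπ0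
    _ = (2 * (r : ℝ) + 1) ^ 3 * (max C 0 * (r : ℝ) ^ (s - 3) * armProb p r) := by
        rw [Finset.sum_const, nsmul_eq_mul, card_box]; push_cast; ring
    _ ≤ 27 * (r : ℝ) ^ (3 : ℕ) * (max C 0 * (r : ℝ) ^ (s - 3) * armProb p r) :=
        mul_le_mul_of_nonneg_right h27 hK
    _ = 27 * max C 0 * (r : ℝ) ^ s * armProb p r := by rw [hsplit]; ring

/-- `{0 ↔_ℍ 0}` is the sure event. [folklore] -/
theorem conn_zero : conn 0 = Set.univ := by
  ext ω
  simp only [Set.mem_univ, iff_true]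
  rw [mem_conn_iff]

/-- The uniform density bound is FALSE for every `s < 3` whenever the arm probabilities are positive:
test it at the root `x = 0`, where `P(0 ↔_ℍ 0, arm) = P(arm)`. [folklore] -/
theorem not_densityBoundAt {p : unitInterval} (hπ : ∀ r : ℕ, 1 ≤ r → 0 < armProb p r) {s : ℝ}
    (hs : s < 3) : ¬ DensityBoundAt p s := by
  rintro ⟨C, hC⟩
  refine not_forall_rpow_le (c := 1) (C := C) (s := s - 3) (t := 0) one_pos (by linarith) fun r hr => ?_
  have h := hC r hr 0 (zero_mem_box 3 r)
  rw [conn_zero, Set.univ_inter] at h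
  have h' : (1 : ℝ) ≤ C * (r : ℝ) ^ (s - 3) := le_of_mul_le_mul_right (by rw [one_mul]; exact h) (hπ r hr)
  rw [Real.rpow_zero]; linarith

/-- At `p_c(ℤ³)`: no uniform density bound with any `s < 3` (in particular not with `s = 11/4`). [folklore] -/
theorem not_densityBoundAt_criticalProbI {s : ℝ} (hs : s < 3) : ¬ DensityBoundAt (criticalProbI 3) s :=
  not_densityBoundAt (fun r _ => armProb_criticalProbI_pos r) hs

/-! ## §4b POSITIVE ASSOCIATION: `M_p(r) ≥ π_p(r) · E_p|C_ℍ(0) ∩ B_r|`. Hence B contains the (still OPEN) sub-volume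
bound `E_{p_c}|C_ℍ(0) ∩ B_r| ≤ C r^{11/4}` for the UNCONDITIONAL truncated half-space susceptibility (BGN gives only
`o(r³)`, no rate), and the conditional density at any FIXED vertex never decays: `ρ_r(x) ≥ τ_ℍ(0,x)`. -/

/-- `{0 ↔_ℍ x}` is increasing. [folklore] -/
theorem isUpperSet_conn (x : V3) : IsUpperSet (conn x) := by
  rw [conn, openConnIn_eq_openConnVia zero_mem_Hs]
  exact isUpperSet_openConnVia _ _ _

/-- `arm_ℍ(0,r)` is increasing. [folklore] -/
theorem isUpperSet_arm (r : ℕ) : IsUpperSet (arm r) := by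
  have : arm r = ⋃ y : V3, ⋃ (_ : ∃ i : Fin 3, (r : ℤ) ≤ |y i|), openConnIn Hs 0 y := by
    ext ω; simp [arm]
  rw [this]
  refine isUpperSet_iUnion fun y => isUpperSet_iUnion fun _ => ?_
  rw [openConnIn_eq_openConnVia zero_mem_Hs]
  exact isUpperSet_openConnVia _ _ _

/-- Harris–FKG: `P_p(0 ↔_ℍ x) · π_p(r) ≤ P_p(0 ↔_ℍ x ∧ arm_r)` — conditioning on the cluster being tall only
increases the probability that it contains `x`. [folklore] -/
theorem real_conn_mul_armProb_le (p : unitInterval) (x : V3) (r : ℕ) :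
    (Pp p).real (conn x) * armProb p r ≤ (Pp p).real (conn x ∩ arm r) :=
  harris_fkg_holds (zdGraph 3) p (isUpperSet_conn x) (isUpperSet_arm r) (measurableSet_conn x)
    (measurableSet_arm r)

/-- The truncated half-space susceptibility `χ_ℍ^{(r)}(p) = E_p|C_ℍ(0) ∩ B_r| = Σ_{x ∈ B_r} P_p(0 ↔_ℍ x)`.
[folklore] -/
def chiH (p : unitInterval) (r : ℕ) : ℝ := ∑ x ∈ box 3 r, (Pp p).real (conn x)

/-- `χ_ℍ^{(r)}(p) · π_p(r) ≤ M_p(r)`. [folklore] -/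
theorem chiH_mul_armProb_le_mass (p : unitInterval) (r : ℕ) : chiH p r * armProb p r ≤ mass p r := by
  rw [chiH, mass, Finset.sum_mul]
  exact Finset.sum_le_sum fun x _ => real_conn_mul_armProb_le p x r

/-- B's cheaper (but still open) shadow: `MassBoundAt p s` with positive arm probabilities implies the sub-volume
bound `χ_ℍ^{(r)}(p) ≤ C r^s` on the UNCONDITIONAL truncated half-space susceptibility. At `p_c` with `s = 11/4`
this consequence is itself unproved (BGN: `τ_ℍ(0,x) ≤ π_ℍ(|x|) → θ_ℍ(p_c) = 0` gives `χ_ℍ^{(r)} = o(r³)` with no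
rate) — a candidate first target for the line, strictly weaker than B. [folklore] -/
theorem chiH_le_of_massBoundAt {p : unitInterval} {s : ℝ} (hπ : ∀ r : ℕ, 1 ≤ r → 0 < armProb p r)
    (h : MassBoundAt p s) : ∃ C : ℝ, ∀ r : ℕ, 1 ≤ r → chiH p r ≤ C * (r : ℝ) ^ s := by
  obtain ⟨C, hC⟩ := h
  refine ⟨C, fun r hr => ?_⟩
  have h1 := (chiH_mul_armProb_le_mass p r).trans (hC r hr)
  exact le_of_mul_le_mul_right h1 (hπ r hr)

/-- In particular the crux implies `χ_ℍ^{(r)}(p_c) ≤ C r^{11/4}`. [folklore] -/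
theorem chiH_criticalProbI_le_of_tallClusterMassBound (h : TallClusterMassBound) :
    ∃ C : ℝ, ∀ r : ℕ, 1 ≤ r → chiH (criticalProbI 3) r ≤ C * (r : ℝ) ^ ((11 : ℝ) / 4) :=
  chiH_le_of_massBoundAt (fun r _ => armProb_criticalProbI_pos r) (tallClusterMassBound_iff.1 h)

/-- The conditional density at a fixed vertex never decays: `ρ_r(x) · π(r) = P(0 ↔_ℍ x ∧ arm_r) ≥ τ_ℍ(0,x) π(r)`
for EVERY `r`; so all the decay B needs must come from `|x| → ∞`, none from `r → ∞` at fixed `x`. [folklore] -/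
theorem density_ge_tau (p : unitInterval) (x : V3) (r : ℕ) (hπ : 0 < armProb p r) :
    (Pp p).real (conn x) ≤ (Pp p).real (conn x ∩ arm r) / armProb p r := by
  rw [le_div_iff₀ hπ]
  exact real_conn_mul_armProb_le p x r


/-! ## §5 The subcritical end `p = 0`: the family is vacuous there (`π_0(r) = 0` for `r ≥ 1`) -/

/-- The empty configuration has no arm of length `r ≥ 1`. [folklore] -/
theorem empty_notMem_arm {r : ℕ} (hr : 1 ≤ r) : (∅ : BondConfig V3) ∉ arm r := by
  intro h
  obtain ⟨y, hy, ⟨w⟩⟩ := mem_arm_iff.1 h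
  have : y = 0 := by
    cases w with
    | nil => rfl
    | cons hadj _ =>
      rw [SimpleGraph.inf_adj, openGraph_adj] at hadj
      exact absurd hadj.1.1 (Set.notMem_empty _)
  subst this
  rw [snorm_zero] at hy
  omega

/-- `π_0(r) = 0` for `r ≥ 1` (`P_0 = δ_∅`). [folklore] -/
theorem armProb_zero {r : ℕ} (hr : 1 ≤ r) : armProb 0 r = 0 := by
  rw [armProb, Pp, bondPercolation, setBernoulli_zero, measureReal_def, Measure.dirac_apply,
    Set.indicator_of_notMem (empty_notMem_arm hr), ENNReal.toReal_zero]

/-- `M_0(r) = 0` for `r ≥ 1`. [folklore] -/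
theorem mass_zero {r : ℕ} (hr : 1 ≤ r) : mass 0 r = 0 :=
  le_antisymm ((mass_le_card_mul 0 r).trans (by rw [armProb_zero hr, mul_zero])) (mass_nonneg 0 r)

/-- At `p = 0` every `MassBoundAt 0 s` holds (both sides vanish): the subcritical end carries no
obstruction; the obstruction (§3) is entirely on the supercritical side. [folklore] -/
theorem massBoundAt_zero (s : ℝ) : MassBoundAt 0 s :=
  ⟨0, fun r hr => by rw [mass_zero hr, armProb_zero hr]; simp⟩


/-! ## §6 The crux is PURELY ASYMPTOTIC: no finite range of `r` can refute it -/

/-- Since `π_p(r) > 0`, an eventual bound (any `C`, all `r ≥ N`) upgrades to a bound for all `r ≥ 1`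
(enlarge `C` by the finitely many ratios below `N`). Consequently NO finite computation — at any
precision, for any finite set of radii — can refute `TallClusterMassBound`; only the `r → ∞` exponent
matters (and `p_c(ℤ³)` is not known in closed form anyway). [folklore] -/
theorem massBoundAt_of_eventually {p : unitInterval} {s : ℝ} (hπ : ∀ r : ℕ, 1 ≤ r → 0 < armProb p r)
    (h : ∃ C : ℝ, ∃ N : ℕ, ∀ r : ℕ, N ≤ r → mass p r ≤ C * (r : ℝ) ^ s * armProb p r) :
    MassBoundAt p s := by
  obtain ⟨C, N, hC⟩ := h
  set f : ℕ → ℝ := fun r => mass p r / ((r : ℝ) ^ s * armProb p r) with hf_def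
  refine ⟨max C 0 + ∑ k ∈ Finset.range N, |f k|, fun r hr => ?_⟩
  have hr0 : (0 : ℝ) < r := by exact_mod_cast hr
  have hden : 0 < (r : ℝ) ^ s * armProb p r := mul_pos (Real.rpow_pos_of_pos hr0 s) (hπ r hr)
  have hS : 0 ≤ ∑ k ∈ Finset.range N, |f k| := Finset.sum_nonneg fun _ _ => abs_nonneg _
  by_cases hrN : N ≤ r
  · calc mass p r ≤ C * (r : ℝ) ^ s * armProb p r := hC r hrN
      _ = C * ((r : ℝ) ^ s * armProb p r) := by ring
      _ ≤ (max C 0 + ∑ k ∈ Finset.range N, |f k|) * ((r : ℝ) ^ s * armProb p r) :=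
          mul_le_mul_of_nonneg_right ((le_max_left _ _).trans (le_add_of_nonneg_right hS)) hden.le
      _ = _ := by ring
  · have hrlt : r ∈ Finset.range N := Finset.mem_range.2 (not_le.1 hrN)
    have hf : mass p r = f r * ((r : ℝ) ^ s * armProb p r) := by
      rw [hf_def, div_mul_cancel₀ _ hden.ne']
    have hfle : f r ≤ max C 0 + ∑ k ∈ Finset.range N, |f k| :=
      (le_abs_self _).trans ((Finset.single_le_sum (fun k _ => abs_nonneg (f k)) hrlt).trans
        (le_add_of_nonneg_left (le_max_right _ _)))
    rw [hf]
    calc f r * ((r : ℝ) ^ s * armProb p r)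
        ≤ (max C 0 + ∑ k ∈ Finset.range N, |f k|) * ((r : ℝ) ^ s * armProb p r) :=
          mul_le_mul_of_nonneg_right hfle hden.le
      _ = _ := by ring

/-- The crux is equivalent to its eventual form. [folklore] -/
theorem tallClusterMassBound_iff_eventually :
    TallClusterMassBound ↔ ∃ C : ℝ, ∃ N : ℕ, ∀ r : ℕ, N ≤ r →
      mass (criticalProbI 3) r ≤ C * (r : ℝ) ^ ((11 : ℝ) / 4) * armProb (criticalProbI 3) r := by
  rw [tallClusterMassBound_iff]
  constructor
  · rintro ⟨C, hC⟩
    exact ⟨C, 1, hC⟩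
  · exact massBoundAt_of_eventually fun r _ => armProb_criticalProbI_pos r

/-! ## §7 Summary theorem: where the crux sits in the `(p, s)` family -/

/-- Everything proved above about the family `MassBoundAt p s` in one statement:
`s = 3` always holds; at `p_c` every `s < 1` fails; at `p = 1` every `s < 3` fails; at `p = 0` every `s`
holds; the uniform-density strengthening fails at `p_c` for every `s < 3`. The crux `(p_c, 11/4)` lies
strictly inside the undecided strip `1 ≤ s < 3` at `p = p_c`. [folklore] -/
theorem family_summary :
    (∀ p, MassBoundAt p 3) ∧ (∀ s : ℝ, s < 1 → ¬ MassBoundAt (criticalProbI 3) s) ∧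
      (∀ s : ℝ, s < 3 → ¬ MassBoundAt 1 s) ∧ (∀ s : ℝ, MassBoundAt 0 s) ∧
      (∀ s : ℝ, s < 3 → ¬ DensityBoundAt (criticalProbI 3) s) :=
  ⟨massBoundAt_three, fun _ hs => not_massBoundAt_criticalProbI_of_lt_one hs,
    fun _ hs => not_massBoundAt_one hs, massBoundAt_zero, fun _ hs => not_densityBoundAt_criticalProbI hs⟩

-- Targets: (none yet — payload.targets / stuck_stubs empty at gen 1; stub kills go here on re-arm)


/-! ## §8 WHY IT RESISTS — and what any proof of B must use (read with §2, §3, §4, §6)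

1. WHAT B SAYS. `m := limsup_r log(M(r)/π(r)) / log r ≤ 11/4`, where `M(r)/π(r) = E[|C_ℍ(0) ∩ B_r| ∣ arm_ℍ(0,r)]`
   is the conditional mass of a tall critical half-space cluster hanging from the wall. Rigorously `1 ≤ m ≤ 3`
   (§2, §1) and NOTHING sharper is known at `p_c(ℤ³)` in either direction.

2. HEURISTIC VALUE `m = d_f ≈ 2.523` (bulk fractal dimension, `d_f = 2.5229(3)`: Wang–Zhou–Zhang–Garoni–Deng,
   PRE 87 (2013) 052107; Xu–Wang–Lv–Deng, Front. Phys. 9 (2014) 113). Scale decomposition: for `|x| ≍ k ≤ r`,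
   `P(0 ↔_ℍ x, arm_r) ≍ π_ℍ(k) · π(k) · π_ℍ(r)/π_ℍ(k)` (wall arm from the root to scale k; bulk arm into x at
   scale k; quasi-multiplicative continuation k → r), so the shell `|x| ≍ k` contributes `k³ π(k) π_ℍ(r)
   = k^{d_f} π_ℍ(r)` (`π(k) = k^{-(3-d_f)} = k^{-β/ν}`, `β/ν ≈ 0.477`), and `M(r)/π_ℍ(r) ≍ Σ_{k ≤ r dyadic} k^{d_f}
   ≍ r^{d_f}`. The WALL exponent `x_s ≈ 0.975` (Deng–Blöte, PRE 71 (2005) 016117) cancels: `m` is a BULK quantity.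
   Exponent dictionary (agrees with crux idea card quarter-arm-transfer): B ⟺ `β/ν = 3 − d_f ≥ 1/4` ⟺ bulk
   one-arm `π(n) ≲ n^{-1/4}`; real world `0.477 > 0.25`, margin `0.227`; jump world `β = 0`, `m = 3`.

3. WHY NO THEOREM REFUTES IT. A refutation needs `m > 11/4` AT `p_c(ℤ³)`, i.e. `β/ν < 1/4` — false in the real
   world by a wide numerical margin, and rigorously out of reach in any world: no lower bound on the conditional
   mass beyond §2's linear one is known (`χ_ℍ(p_c) = E_{p_c}|C_ℍ(0)| = ∞` does hold — split a bulk open path at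
   its LOWEST vertex into two disjoint half-space paths and apply BK: `χ(p) ≤ χ_ℍ(p)²`, and `χ(p_c) = ∞` — but it
   comes without any rate for the truncated `E|C_ℍ(0) ∩ B_r|`).
   §6: no finite-`r` computation refutes an `∃ C` statement with `π > 0`. The ONLY scenario violating B is the
   jump world `θ(p_c) > 0` (wall clusters a.s. finite by BGN yet DENSE): §3 turns 'uniformly dense ⇒ m = 3' into
   the theorem `not_massBoundAt_of_dense`, but uniform density AT `p_c` is exactly what cannot be exhibited —
   `θ_ℍ(p_c) = 0` holds unconditionally (tree: `BarskyGrimmettNewman1991_Z3_holds`), in the jump world too.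
   So B is irrefutable short of refuting `PercolationContinuityZ3`, and (gen-2 route review, recorded on the item)
   it is the ONE statement of the route that a jump world violates: B carries the conjunct.

4. WHAT A PROOF MUST USE (load-bearing analysis).
   (a) `p ≤ p_c`, QUANTITATIVELY: the same inequality is false at `p = 1` (§3, proved) and at every `p > p_c`
       granted half-space uniqueness + Harris–FKG (`UniformlyDense p (θ_ℍ(p)²)`, Grimmett–Marstrand `p_c(ℍ) = p_c`,
       tree fact `GrimmettMarstrand1990_halfSpace`). Since `p_c` is characterised only through `θ`, a proof must
       convert (sub)criticality into a quantitative DENSITY DECAY of wall clusters; BGN's finite-size criterion is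
       qualitative and holds verbatim in the jump world — it yields finiteness, never thinness, so it cannot be
       the engine (the item's 'Tools: BGN finiteness + isoperimetry + AKN counting' do not separate the worlds).
   (b) An AVERAGED, not uniform, density bound: `ρ_r(x) = P(0 ↔_ℍ x ∣ arm_r)` is `≡ 1` at the root (§4), `≍ 1`
       on every fixed neighbourhood of it (FKG), and must decay like `|x|^{-(3-d_f)}` in the bulk; the proof has
       to produce decay of `ρ_r` in `|x|` with exponent `> 1/4` ON AVERAGE over `B_r` — a bulk one-arm-type bound
       `π(n) ≲ n^{-1/4-ε}` or an equivalent mass–radius statement for clusters hanging from a wall. Either is far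
       beyond present `d = 3` technology: in `3 ≤ d ≤ 6` not even `π(n) → 0` — that IS `θ(p_c) = 0`,
       Heydenreich–van der Hofstad 2017 Open Problem 1.1 (p. 13), equivalently `τ_{p_c}(0,x) → 0`
       (tree: `percolationContinuity_iff_tendsto_tau`) — is known.
   (c) A REGULARITY input for wall arms. Independence in disjoint balls gives, for `|x| ≍ k ≤ r`,
       `P(0 ↔_ℍ x, arm_r) ≤ π_ℍ(k/3) · π(k/3) · P(B_{2k} ⇝_ℍ ∂B_r) ≤ π_ℍ(k/3) π(k/3)`, so with (b) the shell sum is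
       `≲ Σ_{k ≤ r} k^{11/4-ε} π_ℍ(k/3)`, and B follows iff this is `≲ r^{11/4} π_ℍ(r)`: enough is EITHER the hard
       direction of quasi-multiplicativity `π_ℍ(k) P(k ⇝ r) ≲ π_ℍ(r)` (unknown in `d = 3`, no RSW) OR merely an
       a-priori polynomial regularity `π_ℍ(r) ≥ c (k/r)^λ π_ℍ(k)` for `k ≤ r` with some `λ < 5/2 − ε` (then the
       dyadic sum converges at the top scale). Even the latter — indeed even a polynomial LOWER bound
       `π_ℍ(r) ≥ c r^{-λ}` for the wall one-arm at `p_c(ℤ³)` — does not seem to be in print (`χ_ℍ = ∞` only gives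
       `Σ_k k³ π_ℍ(k) π(k) = ∞`, i.e. `π_ℍ(2^j) ≥ 2^{-3j}/j²` infinitely often). So B = (b) + (c), both open, with (b)
       the conjunct-strength part and (c) a plausible stand-alone target.
   (d) A DIMENSION-SPECIFIC input: the `d − 1/4` transplant of B is FALSE in `d = 2` — there `m = d_f = 91/48 ≈
       1.896 > 7/4` (site percolation on the triangular lattice: one-arm exponent `5/48`, Lawler–Schramm–Werner
       2002, + Kesten's 1987 scaling relations; numerically identical for bond `ℤ²`), and for `d = 4, 5` the literal
       `11/4` is below `d_f(4) ≈ 3.05`, `d_f(5) ≈ 3.5`. Hence no dimension-free argument (isoperimetry of `ℤ^d`,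
       BGN, AKN-type counting — all valid for every `d ≥ 2`) proves B: the proof must know `β/ν(3) > 1/4`, a
       three-dimensional numerical fact without known structural explanation. This is the sharpest obstruction
       found: B is TRUE (numerically) but sits `0.23` above a non-universal, d-dependent exponent.
   (e) NOT load-bearing: the subcritical side (§5: vacuous at `p = 0`; for `0 < p < p_c` one expects `m = 1`,
       strings) and the lattice truncation `box 3 r ⊋ B_r ∩ ℍ` (terms outside `ℍ` vanish).
   (f) Load-bearing in the TYPING sense: the truncation of the mass to `B_r`. Untruncated, `E_{p_c}[|C_ℍ(0)| ;
       arm_r] = χ_ℍ(p_c) − E[|C_ℍ(0)| ; ¬arm_r] = ∞` for every `r` (the second term is `≤ |B_r|`), so an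
       untruncated variant is false with `∫⁻`/`ℝ≥0∞` sums and junk-TRUE (`= 0`) with a non-summable real `tsum` or
       a Bochner integral — planners restating B must keep the `box 3 r`.

5. CHEAPER TRUE NEIGHBOURS / REPAIR MENU (planner information, not refutations). `s ↦ MassBoundAt p_c s` is
   monotone (§1) with threshold `m ∈ [1, 3]`; the route's glue needs `a₂ > 2m − 3`, so certifying only `m ≤ 3 − δ`
   pushes crux A to `a₂ > 3 − 2δ`, i.e. towards its PREDICTED value `a₂ = 3` with no slack; with the true
   `m ≈ 2.523` the glue needs `a₂ > 2.046` against BK/Reimer's `≈ 1.95`. Every consistent split `(s, a₂)` with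
   `s ≥ d_f`, `a₂ > 2s − 3` is numerically true and none is provable now; `(11/4, 5/2 + κ)` is as good as any.
   A weakening of B that WOULD be provable today must give up the exponent entirely (e.g. `M(r) = o(r³ π(r))`,
   'tall wall clusters have vanishing density' — still open! it is a quantitative shadow of `θ(p_c) = 0`).
   The cleanest STRICTLY WEAKER open statement inside B (§4b, by Harris–FKG): `E_{p_c}|C_ℍ(0) ∩ B_r| ≤ C r^{11/4}`,
   a sub-volume bound for the unconditional truncated half-space susceptibility from a wall point (known: `o(r³)`
   from `τ_ℍ(0,x) ≤ π_ℍ(|x|) → θ_ℍ(p_c) = 0`; heuristic truth `r^{d_f − x_s} ≈ r^{1.55}`, huge margin). A line that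
   cannot prove even this shadow cannot prove B; a line that proves it has produced the first RATE in BGN's theorem
   along the way (compare crux C, QuantitativeBGN) — recommended as the provers' first milestone.

6. NUMERICS. Reviewer kit jobs j001444/j001445 (route notes): `m_eff ≈ 2.3–2.4` at `r ≤ 24`, rising. This seat's
   calibration (kit, `mc/main.py`: vectorised Leath growth of `C_ℍ(0)` in `ℍ ∩ B_R` at `p = 0.24881182`, exact
   `arm_r`, mass exact up to excursions beyond `B_R`, jackknife over batches). SMOKE job j008376 (R = 16,
   N = 4800, 2 s): factor-2 slopes `m_eff(r→2r)` = 1.56(3) [1→2], 1.99(3) [2→4], 2.17(4) [3→6], 2.25(4) [4→8]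
   (truncation-safe range), still rising — pre-asymptotic, consistent with the reviewers' 2.3–2.4 at r ≤ 24 and
   with a drift towards `d_f = 2.52`; the wall one-arm slope `a_eff(4→8) = 0.98` already sits at Deng–Blöte's
   `x_s ≈ 0.975`. PRODUCTION job j008612 (R = 128, N = 4.8·10⁵, r ≤ 64 truncation-safe, `--workitem` so its
   `table.txt` tail auto-attaches to the item) was still queued on a saturated farm when this cycle closed; its
   slopes go here on re-arm. Reading rule: `m_eff(r → 2r)` should drift up towards `2.52` and stay below `2.75`;
   a slope settling above `2.75` at large `r` would discourage B (never refute it, §6).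

7. LITERATURE. Grimmett 1999 Thm (7.35) = Barsky–Grimmett–Newman 1991 (qualitative `θ_ℍ(p_c) = 0`, in tree);
   Chatterjee–Hanson, CPAM 2020 / arXiv:1810.03750 (half-space arm and two-point exponents by mass transport,
   `d > 6` only); Deng–Blöte 2005 (surface exponents of 3D percolation, numerical); Heydenreich–van der Hofstad
   2017, Open Problem 1.1 (`θ(p_c) = 0` ⟺ `τ_{p_c} → 0`; read: PDF p. 13) and p. 221 (BGN's block
   renormalisation 'to prove that percolation does not occur in half-spaces');
   Kozma–Nachmias 2011 (bulk one-arm `n^{-2}`, `d > 6`). No printed bound on the conditional mass of wall-rooted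
   critical clusters in `d = 3` in either direction was found (grounder + two route reviews + this seat: galaxy
   pdf bm25/intelligent 'fractal dimension percolation half-space surface cluster boundary' / 'percolation clusters
   attached to a wall … three dimensions' — 0 relevant of 27; `lit search` remote+local legs DEGRADED (searchd rc 75,
   3 attempts 00:40–01:05Z) — to be re-run on re-arm; nothing in `ledger negatives` bears on B).
-/

end Summit.CriticalPhenomena.PercolationContinuityZ3.Cruxes.TallClusterMassBound.Disproof
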